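import Mathlib
import Literature.Geometry.Symplectic.JHolomorphicSheetDbar
import HarnessLib

/-!
# `|∂̄ c| ≤ M |c|` for the normal coordinate of a second `J`-sheet — local hypotheses

Local form of `Literature.Geometry.Symplectic.sheetDbarInequality`
(`Literature/Geometry/Symplectic/JHolomorphicSheetDbar.lean`; McDuff–Salamon (2012), §2.4 /
App. E): the `J`-complex-linearity of `dE` along the axis `{w = 0}` is only required for
`‖ζ - ξ₁‖ < r` (the first sheet need only be `J`-holomorphic near the point), which is what the
sheet chart of a locally `J`-holomorphic immersed sheet provides
(`Literature/Geometry/Symplectic/JHolomorphicSheetChart.lean`, `sheetChartDeriv_hol`). The proof is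
the same: the defect `Δ(p) = J (E p) ∘ dE_p - dE_p ∘ (i ⊕ i)` vanishes on the axis INSIDE the ball,
hence `‖Δ(z, w)‖ ≤ C ‖w‖` on the ball (mean value inequality,
`SheetDbarLocal.norm_le_mul_norm_snd_of_vanish_of_ball`), and the chain rule for the
`J`-holomorphic curve `E ∘ (a, c)` gives `‖∂̄ c‖ ≤ M ‖c‖` on a smaller closed disc.

* `sheetDbarInequality_local`.

## References

* D. McDuff, D. Salamon, *J-holomorphic curves and symplectic topology*, 2nd ed. (2012), §2.4,
  App. E. [McDuffSalamon2012]
-/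

noncomputable section

open Filter Set Metric
open scoped ContDiff Topology

namespace Literature.Geometry.Symplectic

namespace SheetDbarLocal

/-- A `C¹` map on `ℂ × ℂ` vanishing on the part of the axis `{w = 0}` inside the ball
`B((ξ₁, 0), r)` is `O(‖w‖)` on that ball (mean value inequality with a derivative bound on the
compact closed ball; local form of `SheetDbar.norm_le_mul_norm_snd_of_vanish`). [folklore] -/
theorem norm_le_mul_norm_snd_of_vanish_of_ball {G : Type*} [NormedAddCommGroup G]
    [NormedSpace ℝ G] (f : ℂ × ℂ → G) (hf : ContDiff ℝ 1 f) (ξ₁ : ℂ) (r : ℝ) (hr : 0 < r)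
    (h0 : ∀ z : ℂ, ‖z - ξ₁‖ < r → f (z, 0) = 0) :
    ∃ C : ℝ, 0 ≤ C ∧ ∀ p ∈ ball ((ξ₁, 0) : ℂ × ℂ) r, ‖f p‖ ≤ C * ‖p.2‖ := by
  obtain ⟨C, hC⟩ := (isCompact_closedBall ((ξ₁, 0) : ℂ × ℂ) r).exists_bound_of_continuousOn
    (hf.continuous_fderiv one_ne_zero).continuousOn
  have hC0 : 0 ≤ C := (norm_nonneg _).trans (hC _ (mem_closedBall_self hr.le))
  refine ⟨C, hC0, fun p hp => ?_⟩
  have hp1 : ‖p.1 - ξ₁‖ < r := by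
    rw [mem_ball, Prod.dist_eq] at hp
    have h1 := lt_of_le_of_lt (le_max_left _ _) hp
    rwa [dist_eq_norm] at h1
  have hp0 : ((p.1, 0) : ℂ × ℂ) ∈ ball ((ξ₁, 0) : ℂ × ℂ) r := by
    rw [mem_ball, Prod.dist_eq] at hp ⊢
    have h1 := lt_of_le_of_lt (le_max_left _ _) hp
    simpa using h1
  have key := (convex_ball ((ξ₁, 0) : ℂ × ℂ) r).norm_image_sub_le_of_norm_fderiv_le
    (fun x _ => (hf.differentiable one_ne_zero) x)
    (fun x hx => hC x (ball_subset_closedBall hx)) hp0 hp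
  rw [h0 p.1 hp1, sub_zero] at key
  have hn : ‖p - (p.1, 0)‖ = ‖p.2‖ := by
    obtain ⟨z, w⟩ := p
    simp
  rwa [hn] at key

end SheetDbarLocal

variable {F : Type*} [NormedAddCommGroup F] [NormedSpace ℝ F]

/-- **Scalar reduction with local hypotheses.** As `sheetDbarInequality`, but the
`J`-complex-linearity `J (E (ζ,0)) ∘ dE_{(ζ,0)} = dE_{(ζ,0)} ∘ (i ⊕ i)` is only assumed for
`‖ζ - ξ₁‖ < r`: the normal coordinate `c` of a `J`-holomorphic curve `E ∘ (a, c)` staying in the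
ball `B((ξ₁,0), r)` satisfies `‖∂̄ c‖ ≤ M ‖c‖` on a closed disc about `ζ₂`.
[cite: McDuffSalamon2012, §2.4 and App. E (reduction to the similarity principle)] -/
theorem sheetDbarInequality_local (J : F → F →L[ℝ] F) (hJs : ContDiff ℝ ∞ J)
    (E : ℂ × ℂ → F) (hE : ContDiff ℝ ∞ E) (ξ₁ : ℂ) (r B : ℝ) (hr : 0 < r)
    (hhol : ∀ ζ : ℂ, ‖ζ - ξ₁‖ < r → ∀ α β : ℂ, J (E (ζ, 0)) (fderiv ℝ E (ζ, 0) (α, β)) =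
      fderiv ℝ E (ζ, 0) (Complex.I * α, Complex.I * β))
    (hB : ∀ p ∈ ball ((ξ₁, 0) : ℂ × ℂ) r, ∀ q : ℂ × ℂ, ‖q‖ ≤ B * ‖fderiv ℝ E p q‖)
    (a c : ℂ → ℂ) (ζ₂ : ℂ) (ρ₀ : ℝ) (hρ₀ : 0 < ρ₀)
    (ha : ContDiffOn ℝ ∞ a (ball ζ₂ ρ₀)) (hc : ContDiffOn ℝ ∞ c (ball ζ₂ ρ₀))
    (hin : ∀ ζ ∈ ball ζ₂ ρ₀, (a ζ, c ζ) ∈ ball ((ξ₁, 0) : ℂ × ℂ) r)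
    (hJhol : ∀ ζ ∈ ball ζ₂ ρ₀, ∀ θ : ℂ,
      fderiv ℝ (fun ζ => E (a ζ, c ζ)) ζ (Complex.I * θ) =
        J (E (a ζ, c ζ)) (fderiv ℝ (fun ζ => E (a ζ, c ζ)) ζ θ)) :
    ∃ ρ M : ℝ, 0 < ρ ∧ ρ < ρ₀ ∧ 0 ≤ M ∧
      ∀ ζ ∈ closedBall ζ₂ ρ, ‖Literature.Analysis.Complex.dbarAlong 1 c ζ‖ ≤ M * ‖c ζ‖ := by
  -- the operator `i ⊕ i` on `ℂ × ℂ`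
  obtain ⟨Iop, hIop⟩ : ∃ Iop : ℂ × ℂ →L[ℝ] ℂ × ℂ,
      ∀ q : ℂ × ℂ, Iop q = (Complex.I * q.1, Complex.I * q.2) :=
    ⟨Complex.I • ContinuousLinearMap.id ℝ (ℂ × ℂ), fun q => by
      obtain ⟨α, β⟩ := q
      simp⟩
  -- the defect of `J`-complex-linearity of `dE`
  obtain ⟨Δ, hΔ⟩ : ∃ Δ : ℂ × ℂ → (ℂ × ℂ →L[ℝ] F),
      Δ = fun p => (J (E p)).comp (fderiv ℝ E p) - (fderiv ℝ E p).comp Iop := ⟨_, rfl⟩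
  have hD : ContDiff ℝ ∞ (fun p => fderiv ℝ E p) := (contDiff_infty_iff_fderiv.1 hE).2
  have hJE : ContDiff ℝ ∞ (fun p => J (E p)) := hJs.comp hE
  have hΔs : ContDiff ℝ 1 Δ := by
    rw [hΔ]
    exact ((hJE.clm_comp hD).sub (hD.clm_comp contDiff_const)).of_le (by simp)
  have hΔ0 : ∀ z : ℂ, ‖z - ξ₁‖ < r → Δ (z, 0) = 0 := by
    intro z hz
    rw [hΔ]
    refine ContinuousLinearMap.ext fun q => ?_
    obtain ⟨α, β⟩ := q
    simp only [sub_apply, ContinuousLinearMap.comp_apply, hIop, zero_apply, hhol z hz, sub_self]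
  obtain ⟨C, hC0, hC⟩ := SheetDbarLocal.norm_le_mul_norm_snd_of_vanish_of_ball Δ hΔs ξ₁ r hr hΔ0
  -- uniform bounds for `da`, `dc` on the closed half disc
  have hsub : closedBall ζ₂ (ρ₀ / 2) ⊆ ball ζ₂ ρ₀ := closedBall_subset_ball (by linarith)
  have hca : ContinuousOn (fderiv ℝ a) (ball ζ₂ ρ₀) :=
    ha.continuousOn_fderiv_of_isOpen isOpen_ball (by simp)
  have hcc : ContinuousOn (fderiv ℝ c) (ball ζ₂ ρ₀) :=
    hc.continuousOn_fderiv_of_isOpen isOpen_ball (by simp)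
  obtain ⟨Ga, hGa⟩ :=
    (isCompact_closedBall ζ₂ (ρ₀ / 2)).exists_bound_of_continuousOn (hca.mono hsub)
  obtain ⟨Gc, hGc⟩ :=
    (isCompact_closedBall ζ₂ (ρ₀ / 2)).exists_bound_of_continuousOn (hcc.mono hsub)
  have hGa0 : 0 ≤ Ga := (norm_nonneg _).trans (hGa ζ₂ (mem_closedBall_self (by linarith)))
  have hM0 : 0 ≤ max B 0 * C * max Ga Gc / 2 :=
    div_nonneg (mul_nonneg (mul_nonneg (le_max_right B 0) hC0) (hGa0.trans (le_max_left Ga Gc)))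
      zero_le_two
  refine ⟨ρ₀ / 2, max B 0 * C * max Ga Gc / 2, by linarith, by linarith, hM0, fun ζ hζ => ?_⟩
  have hζ' : ζ ∈ ball ζ₂ ρ₀ := hsub hζ
  -- chain rule for `E ∘ γ`, `γ = (a, c)`
  have hda : HasFDerivAt a (fderiv ℝ a ζ) ζ :=
    ((ha.contDiffAt (isOpen_ball.mem_nhds hζ')).differentiableAt (by simp)).hasFDerivAt
  have hdc : HasFDerivAt c (fderiv ℝ c ζ) ζ :=
    ((hc.contDiffAt (isOpen_ball.mem_nhds hζ')).differentiableAt (by simp)).hasFDerivAt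
  obtain ⟨γ', hγ'⟩ : ∃ γ' : ℂ →L[ℝ] ℂ × ℂ, γ' = (fderiv ℝ a ζ).prod (fderiv ℝ c ζ) := ⟨_, rfl⟩
  have hγ'ap : ∀ θ : ℂ, γ' θ = (fderiv ℝ a ζ θ, fderiv ℝ c ζ θ) := fun θ => by
    rw [hγ']
    rfl
  have hγ : HasFDerivAt (fun ζ => (a ζ, c ζ)) γ' ζ := hγ' ▸ hda.prodMk hdc
  have hEd : HasFDerivAt E (fderiv ℝ E (a ζ, c ζ)) (a ζ, c ζ) :=
    ((hE.differentiable (by simp)) _).hasFDerivAt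
  have hcomp : HasFDerivAt (fun ζ => E (a ζ, c ζ)) ((fderiv ℝ E (a ζ, c ζ)).comp γ') ζ :=
    hEd.comp ζ hγ
  have key := hJhol ζ hζ' 1
  rw [hcomp.fderiv, mul_one, ContinuousLinearMap.comp_apply, ContinuousLinearMap.comp_apply]
    at key
  -- the identity `dE (γ' i - (i ⊕ i) γ' 1) = Δ (γ ζ) (γ' 1)`
  have hΔap : J (E (a ζ, c ζ)) (fderiv ℝ E (a ζ, c ζ) (γ' 1)) =
      Δ (a ζ, c ζ) (γ' 1) + fderiv ℝ E (a ζ, c ζ) (Iop (γ' 1)) := by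
    rw [hΔ]
    simp
  have hdiff : fderiv ℝ E (a ζ, c ζ) (γ' Complex.I - Iop (γ' 1)) = Δ (a ζ, c ζ) (γ' 1) := by
    rw [map_sub, key, hΔap]
    abel
  -- lower bound on `dE` and the Lipschitz bound on `Δ`
  have h1 : ‖γ' Complex.I - Iop (γ' 1)‖ ≤ max B 0 * (C * ‖c ζ‖ * ‖γ' 1‖) := by
    calc ‖γ' Complex.I - Iop (γ' 1)‖
        ≤ B * ‖fderiv ℝ E (a ζ, c ζ) (γ' Complex.I - Iop (γ' 1))‖ := hB _ (hin ζ hζ') _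
      _ ≤ max B 0 * ‖fderiv ℝ E (a ζ, c ζ) (γ' Complex.I - Iop (γ' 1))‖ :=
          mul_le_mul_of_nonneg_right (le_max_left _ _) (norm_nonneg _)
      _ = max B 0 * ‖Δ (a ζ, c ζ) (γ' 1)‖ := by rw [hdiff]
      _ ≤ max B 0 * (C * ‖c ζ‖ * ‖γ' 1‖) := by
          apply mul_le_mul_of_nonneg_left _ (le_max_right _ _)
          calc ‖Δ (a ζ, c ζ) (γ' 1)‖ ≤ ‖Δ (a ζ, c ζ)‖ * ‖γ' 1‖ :=
                ContinuousLinearMap.le_opNorm _ _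
            _ ≤ C * ‖c ζ‖ * ‖γ' 1‖ :=
                mul_le_mul_of_nonneg_right (hC _ (hin ζ hζ')) (norm_nonneg _)
  -- the second component
  have h2 : ‖fderiv ℝ c ζ Complex.I - Complex.I * fderiv ℝ c ζ 1‖ ≤
      ‖γ' Complex.I - Iop (γ' 1)‖ := by
    have h : (γ' Complex.I - Iop (γ' 1)).2 =
        fderiv ℝ c ζ Complex.I - Complex.I * fderiv ℝ c ζ 1 := by
      rw [Prod.snd_sub, hIop, hγ'ap, hγ'ap]
    rw [← h]
    exact norm_snd_le _
  -- the bound on `γ' 1`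
  have h3 : ‖γ' 1‖ ≤ max Ga Gc := by
    rw [hγ'ap, Prod.norm_mk]
    exact max_le_max ((ContinuousLinearMap.unit_le_opNorm _ _ (by simp)).trans (hGa ζ hζ))
      ((ContinuousLinearMap.unit_le_opNorm _ _ (by simp)).trans (hGc ζ hζ))
  have h4 : ‖fderiv ℝ c ζ Complex.I - Complex.I * fderiv ℝ c ζ 1‖ ≤
      max B 0 * (C * ‖c ζ‖ * max Ga Gc) :=
    h2.trans (h1.trans (by gcongr))
  rw [Literature.Analysis.Complex.dbarAlong_one, norm_smul, smul_eq_mul,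
    SheetDbar.norm_add_I_mul_eq]
  have h5 : ‖(2 : ℂ)⁻¹‖ = 2⁻¹ := by simp
  rw [h5]
  calc 2⁻¹ * ‖fderiv ℝ c ζ Complex.I - Complex.I * fderiv ℝ c ζ 1‖
      ≤ 2⁻¹ * (max B 0 * (C * ‖c ζ‖ * max Ga Gc)) := by gcongr
    _ = max B 0 * C * max Ga Gc / 2 * ‖c ζ‖ := by ring

end Literature.Geometry.Symplectic

end
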